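import Literature.NumberTheory.EllipticCurves.KatoAdditiveTwistedValueNeronIntegralityThree
import HarnessLib

/-!
# Kato's Euler system read in Néron units at the additive prime `3`, KOSTERS–PANNEKOEK-INDEXED (F₃♮)

Statement-only Literature file (named facts; proofs/corollaries in the sibling
`KatoAdditiveTwistedValueNeronIntegralityThreeKPForms.lean`).  Cell `bsd-f2-manin` (D-0131 (3) frontier), planner es
g22 MEMO-es §36 «UN-WEAKEN (P5)», typing ask T-es-29 (a) (2026-08-28T19:47:35Z); vendored by the cell typer g14
(literature-prover lane) from HOME/es/Sketch-es-g22.lean sha16 14d471371a4b85c6 §1 (unchanged through v3 sha16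
20af58d791d39f75), statements VERBATIM.

WHAT THIS IS.  The landed fact F₃ `kato_neron_isIntegral_twistedSymbolSum_of_additive_three_polar` (this directory,
`…Three.lean`) DERIVES in its docstring, step (P5), the conclusion «`Σ_b χ(b) σ_b(X)` is `3`-integral whenever
`χ(3)·ā ≠ 1`», `ā = \overline{8a₂/3} ∈ 𝔽₃` the Kosters–Pannekoek invariant of a model with `a_i ∈ 3ℤ₃`
[KostersPannekoek2017, Thm. 1 (ii), Lemma 7, §3.3.1], and then STATES only the curve-free weakening `χ(3) ∉ {1, −1}`.
F₃♮ below is F₃ VERBATIM with the two binders `χ(3) ≠ 1`, `χ(3) ≠ −1` replaced by the single binder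
`χ(3)·ā(V) ≠ 1`, where `ā(V) = kpSignThree V ∈ {0, 1, −1} ⊂ ℂ` is read INTRINSICALLY off `c₆(V)`.  Same provenance as
F₃ exactly ((8.1.3), Thm. 9.7, Thm. 6.6 (1), remark after (12.8.1) of [Kato2004Asterisque]; [KostersPannekoek2017];
[KimNakamura2020]; the derivation (P1)–(P5) written out in `…Three.lean`, checked by refuter-1 §R34 and refuter-2 §L⁷);
the ONLY new step is the `c₆`-reading of `ā`:

THE `c₆`-READING (es MEMO-es §36.1; re-derived independently by the typer at filing).  Let `V/ℚ` be globally minimal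
and ADDITIVE at `3`.  Tate's algorithm moves the singular point of the reduction to the origin and kills `a₁ mod 3`
by an `(r, s, t)`-change with `u = 1`, after which `a₁ ≡ a₃ ≡ a₄ ≡ a₆ ≡ 0` and (cusp) `b₂ = a₁² + 4a₂ ≡ 0`, so all
`a_i = 3k_i` (the K–P normal form is `u = 1`-equivalent to the minimal model).  In such a model
`b₂ = 3(3k₁² + 4k₂)`, `b₄ = 3(2k₄ + 3k₁k₃)`, `b₆ = 3(3k₃² + 4k₆)`, hence
`c₆ = −b₂³ + 36 b₂ b₄ − 216 b₆ = 27·(−β₂³ + 12 β₂ β₄′ − 24 β₆′)` with `β₂ = 3k₁² + 4k₂ ≡ k₂ (mod 3)`, so `27 ∣ c₆` and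
`c₆/27 ≡ −β₂³ ≡ −k₂ (mod 3)`, while `ā = \overline{8a₂/3} = \overline{8k₂} ≡ −k₂ (mod 3)`: **`ā ≡ c₆/27 (mod 3)`**.
Both sides are invariants: `c₆` is unchanged by every `u = 1` change, and any `u = 1` change preserving «all `a_i ≡ 0
(mod 3)`» has `s ≡ t ≡ r ≡ 0 (mod 3)` (from `a₁′, a₃′, a₆′ ≡ 2s, 2t, r³`), whence `a₂′/3 ≡ a₂/3 (mod 3)`.  Numerical
check (es, in-seat): the map `c₆/27 mod 3 ↦ {0 ↦ never, 1 ↦ always, 2 ↦ ℚ₉-only}` agrees with the Kosters–Pannekoek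
class computed by engine E16 on 4313/4313 curves with `9 ∣ N ≤ 5000` (never 1491 · always 1457 · ℚ₉-only 1365).

HONESTY.  Derived reading, weaker than the derivation, never stronger; NOT a statement in print (nearest printed
phenomenon: Delbourgo 2002 §1, the correction `ℓ_p(E)` for the same pole of `exp*`).  Audits at filing: F₃'s
(P1)–(P5) — refuter-1 §R34, refuter-2 §L⁷ (landed); the `c₆`-reading — es derivation + typer re-derivation above +
es's 4313/4313 engine check; refuter-1 R-es-43 («audit c₆-reading of ā, F₃♮ vs (P5), both parities») REQUESTED
19:47:35Z, no verdict at filing (20:0xZ) — a finding is repaired under a NEW name (append-only rule).  No `_holds` (size XL, as F₃).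
Flag for the referee: `Kato-(8.1.3)-9.7-6.6-KostersPannekoek-3.3.1-additive-three-twisted-Neron-reading-KP-indexed`.
BSD is not proved by this; Manin's `c = 1` is not proved by this.
-/

noncomputable section

open scoped MatrixGroups ModularForm Classical

open CongruenceSubgroup Literature.NumberTheory.EllipticCurves.ModularForms

namespace Literature.NumberTheory.EllipticCurves

/-- **`ā(V)` — the Kosters–Pannekoek invariant of `V` at `3`, lifted to `{0, 1, −1} ⊂ ℂ`, read off `c₆`.**
For `V` integral, globally minimal and ADDITIVE at `3`: `27 ∣ c₆(V)` and `ā(V) = \overline{8a₂/3}` (K–P normal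
form) `≡ c₆(V)/27 (mod 3)` (module docstring); `0` = never-exceptional (Kim–Nakamura: `E₀(K)[3] = 0` for every
unramified `K/ℚ₃`), `1` = always (`E₀(ℚ₃)[3] ≠ 0`, `a₂ ≡ 6 (mod 9)`), `−1` = exceptional over `ℚ₉` only.  Outside
that regime the value is junk and never used.  (es g22 VERBATIM.)
[cite: KostersPannekoek2017, Thm. 1 (ii), Cor. 2 (ii), Lemma 7 (the invariant 8a₂/3; the c₆-reading is the cell's computation, module docstring)] -/
def kpSignThree (V : WeierstrassCurve ℚ) : ℂ :=
  if ∃ k : ℤ, V.c₆ = 81 * k then 0 else if ∃ k : ℤ, V.c₆ = 81 * k + 27 then 1 else -1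

/-- **F₃♮ — Kato's Euler system read in Néron units at the ADDITIVE prime `3` with `E[3]` irreducible,
KOSTERS–PANNEKOEK-INDEXED**: the binders of `kato_neron_isIntegral_twistedSymbolSum_of_additive_three_polar` VERBATIM
with the two binders `χ(3) ≠ 1`, `χ(3) ≠ −1` replaced by the single binder `χ(3)·ā(V) ≠ 1`, `ā(V) = kpSignThree V`
— the CONCLUSION of that fact's derivation step (P5) («`Λ(χ, X)` is `3`-integral whenever `χ(3)·ā ≠ 1`»)
un-weakened.  Same provenance exactly (Kato (8.1.3), Thm 6.6 (1), 9.7, 12.5 (1); K–P Thm 1/Lemma 9; (P1)–(P5),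
refuter-1 §R34); the only new step is the `c₆`-reading of `ā` (module docstring).  Derived reading; refuter-1 R-es-43
REQUESTED at filing.  F₃♮ ⟹ F₃ (`polar_of_kp`, sibling Forms file).  (es g22 VERBATIM.)
[cite: Kato2004Asterisque, (8.1.3) (p. 180), Thm. 9.7 (p. 189), Thm. 6.6 (1) (p. 163), remark after (12.8.1) (p. 223)]
[cite: KostersPannekoek2017, Thm. 1 (ii), Cor. 2 (ii), Lemma 7, Prop. 10, §3.3.1 (table p = 3)]
[cite: KimNakamura2020, §2.1 and Cor. 2.4] -/
def kato_neron_isIntegral_twistedSymbolSum_of_additive_three_kp : Prop :=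
  ∀ (V : WeierstrassCurve ℚ) [V.IsElliptic] [V.IsGloballyMinimal] {N : ℕ} [NeZero N]
    (f : CuspForm (Gamma0 N) 2) (_ : IsNewformOf V f)
    (_ : ¬ V.HasGoodReductionAtPrime 3) (_ : ¬ V.HasMultiplicativeReductionAtPrime 3)
    (_ : V.HasIrreducibleModPGaloisRep 3) (m : ℕ) [NeZero m] (_ : m.Coprime (3 * N))
    (χ : DirichletCharacter ℂ m) (_ : χ.IsPrimitive) (_ : χ ≠ 1) (_ : ¬ 3 ∣ orderOf χ)
    (_ : χ (3 : ZMod m) * kpSignThree V ≠ 1) (ϖ : ℚ) (r : ℂ),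
    (χ.Even → (ϖ : ℝ) * V.realPeriodRat = plusPeriod f →
      (∏ ℓ ∈ N.primeFactors with ¬ ℓ ^ 2 ∣ N,
          (((ℓ : ℂ) - (V.LFunction ℓ : ℂ) * χ (ℓ : ZMod m)) *
            ((ℓ : ℂ) - (V.LFunction ℓ : ℂ) * (χ (ℓ : ZMod m))⁻¹))) *
          twistedSymbolSum f χ = r * (plusPeriod f : ℂ) →
      ∃ s : ℕ, ¬ 3 ∣ s ∧ IsIntegral ℤ ((s : ℂ) * ϖ * r)) ∧
    (χ.Odd → (ϖ : ℝ) * V.imaginaryPeriodRat = minusPeriod f →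
      (∏ ℓ ∈ N.primeFactors with ¬ ℓ ^ 2 ∣ N,
          (((ℓ : ℂ) - (V.LFunction ℓ : ℂ) * χ (ℓ : ZMod m)) *
            ((ℓ : ℂ) - (V.LFunction ℓ : ℂ) * (χ (ℓ : ZMod m))⁻¹))) *
          twistedSymbolSum f χ = r * (minusPeriod f : ℂ) * Complex.I →
      ∃ s : ℕ, ¬ 3 ∣ s ∧ IsIntegral ℤ ((s : ℂ) * ϖ * r))

/-- **F₃♮ at ONE member `V` of the class of `f`** — `KatoFactThreeAt V f` (`…SymbolClosure.lean`) with the same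
replacement of the two `χ(3)`-binders by `χ(3)·ā(V) ≠ 1`; the shape consumed by the cell's KP lever.  A predicate
(nothing asserted).  (es g22 VERBATIM.)
[cite: Kato2004Asterisque, Thm. 6.6 (1) (p. 163) (shape; per-member form of F₃♮)] -/
def KatoFactThreeAtKP (V : WeierstrassCurve ℚ) [V.IsElliptic] [V.IsGloballyMinimal] {N : ℕ} [NeZero N]
    (f : CuspForm (Gamma0 N) 2) : Prop :=
  ∀ (_ : IsNewformOf V f)
    (_ : ¬ V.HasGoodReductionAtPrime 3) (_ : ¬ V.HasMultiplicativeReductionAtPrime 3)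
    (m : ℕ) [NeZero m] (_ : m.Coprime (3 * N))
    (χ : DirichletCharacter ℂ m) (_ : χ.IsPrimitive) (_ : χ ≠ 1) (_ : ¬ 3 ∣ orderOf χ)
    (_ : χ (3 : ZMod m) * kpSignThree V ≠ 1) (ϖ : ℚ) (r : ℂ),
    (χ.Even → (ϖ : ℝ) * V.realPeriodRat = plusPeriod f →
      (∏ ℓ ∈ N.primeFactors with ¬ ℓ ^ 2 ∣ N,
          (((ℓ : ℂ) - (V.LFunction ℓ : ℂ) * χ (ℓ : ZMod m)) *
            ((ℓ : ℂ) - (V.LFunction ℓ : ℂ) * (χ (ℓ : ZMod m))⁻¹))) *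
          twistedSymbolSum f χ = r * (plusPeriod f : ℂ) →
      ∃ s : ℕ, ¬ 3 ∣ s ∧ IsIntegral ℤ ((s : ℂ) * ϖ * r)) ∧
    (χ.Odd → (ϖ : ℝ) * V.imaginaryPeriodRat = minusPeriod f →
      (∏ ℓ ∈ N.primeFactors with ¬ ℓ ^ 2 ∣ N,
          (((ℓ : ℂ) - (V.LFunction ℓ : ℂ) * χ (ℓ : ZMod m)) *
            ((ℓ : ℂ) - (V.LFunction ℓ : ℂ) * (χ (ℓ : ZMod m))⁻¹))) *
          twistedSymbolSum f χ = r * (minusPeriod f : ℂ) * Complex.I →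
      ∃ s : ℕ, ¬ 3 ∣ s ∧ IsIntegral ℤ ((s : ℂ) * ϖ * r))

end Literature.NumberTheory.EllipticCurves

end
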